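import Summits.QuantumFields.YangMills.Theorems.UnitScaleTiltProp8FlatCubeOpsText
import HarnessLib

/-!
# Route `UnitScaleTilt`, crux K1 child «MinimiserStabilityRegPr» (stmt-QuantumFields-19200), v8 pillar **P2 `stub_flatOpsCubeSeq`** (text of record
# `FlatCubeOpsText.FlatOpsAdmAtMS`, p537056) — OWNER RULING g21-№4 §B3(a) «STATEMENTS + ASSEMBLY PROOFS = the P2 author lineage, as Theorems files
# `…Prop8FlatOpsLetters*.lean` deriving the P2 letters from the port's NAMED k-level rows … `H = GQ*(QGQ*)⁻¹` and `G̃ = G − HQG` are consumer algebra over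
# `FlatCubeOperators`; any print letter the algebra needs and the port lacks enters as a NAMED HYPOTHESIS of that file, not a sorry»:
# **THE ASSEMBLY — `FlatOpsAdmAtMS` FROM A NAMED ROW LIST (`RowsAt`) AND NOTHING ELSE**

Cell `ym3-torus` (HUMAN RULING D-0037, YM ladder rung R3), seat `ym3-torus-p1` gen 16.  `--supports stmt-QuantumFields-19200 --as helper`; count-neutral.

THE PRINT.  [Balaban1985Variational] p. 302: *«all the operators in this section are taken without any external gauge field configuration … These operators
were considered in [2, 3]»*; (158) *«A₁ + G̃((δ/δA′)V)(A₁ + HB) = 0»*, p. 300 after (143): *«GP₀* = G − GQ*(QGQ*)⁻¹QG = G̃»*; (165) p. 304: the letters of `G̃`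
(first order and the Laplacian) multiply Prop. 4's current size; (46) p. 285 and (161)–(163) p. 303: the letters of `H`.  [Balaban1984PropagatorsII] Prop. 2.6
(2.136) p. 247: *«|(GJ)(x)|, |(∇GJ)(x)|, |(G∇*J)(x)|, |(ΔGJ)(x)| ≦ O(1)[(Lʲη)², Lʲη, Lʲη, 1]e^{−δ₃d(y,y′)}|J|»* — summed over the source blocks with the
data weight `(L^{j′}η)⁻³` these are the operator rows `(−3) → (−1), (−2), Δ` of [Balaban1985Variational] (117) p. 295 for the genuine `G = Δ_a⁻¹`;
Cor. 2.8 (2.150)–(2.151) p. 249 for `H`; [Balaban1985Variational] (130) p. 298 *«|Δ_{U₀}H₀B|_{(−3)} ≦ B₀|B|»* (the Laplacian row of `H`).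

WHAT THIS FILE DOES (sorry-free; axioms standard).  For EVERY nested family `D : B6SectADomainsV1.Domains (F.P K)` at the d = 3 carrier:
* §1 the canonical plain-function operators: `Qfun D` (p21's `QE D` read on `PBond → ℝ`), **`flatH F n K D`** (r03/p21's `hOp (GE D)(QsE D)(EE D)` at lattice
  factor `L^{K−n}`, `a ≡ 1`, read on plain functions; `isFlatH_flatH : IsFlatH … (flatH …)` by `rfl`), the pinning **`IsFlatGW hw′ G`** of a plain-function `G` to
  the GENUINE propagator `GE D` with an ARBITRARY positive weight family `w′` (print's `a`; [Balaban1984PropagatorsII] (2.16) band — `G = Δ_a⁻¹` depends on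
  `a`, `H` and `G̃` do not: `FlatCubeOperators.hOp_eq_hOp`/`Gt_eq_Gt`), and **`gtOf F n K D G := G − flatH ∘ Qfun ∘ G`** with
  **`isFlatGt_gtOf : IsFlatGW hw′ G → IsFlatGt … (gtOf … G)`** (canonicity moves the weights);
* §2 the three row schemas the algebra needs BESIDES the text's own (`HSupLetterG`, `HDecayLetterD`, `RowSum162`, `GtSupLetterG`, `GtLaplaceLetterG` — the
  last two are used AS THE `G`-ROWS: their shape does not care whether the operator is `G` or `G̃`): **`HLapLetterG`** (the Laplacian sup row (130) of `H`),
  **`QContrLetter`** (the level-weighted contraction `(L^{j(c)}η)|(Qu)(c)| ≤ C_Q·sup_b (L^{j(b)}η)|u(b)|` of the averaging — lattice geometry, PROVED in the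
  companion file `…Prop8FlatCubeQContraction`, here a named row so that this file is pure algebra);
* §3 monotonicity of every letter in its constant, nonnegativity of the level weights;
* §4 **`gtSupLetterG_gtOf`**, **`gtLaplaceLetterG_gtOf`** — the letters of `G̃ = G − HQG` from the rows of `G`, `Q`, `H` (the triangle inequality of the F4 pen's
  `FlatConstrainedPropagatorLetters.letters_G_sub_HQG`, here in the GUARDED multi-weight shapes of the registered text and with the Laplacian row);
* §5 **`RowsAt F n K D w B₀ δ₀ B₃ C_G C_Q`** = THE INPUT LIST OF P2 AS ONE PROP (H-rows: (46) `HSupLetterG`, (130) `HLapLetterG`, (161)₁ `HDecayLetterD` over a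
  distance `dBI ≥ distBI` with the (162) row sum `RowSum162`; G-rows: (2.136)₁,₂,₄ = `GtSupLetterG`/`GtLaplaceLetterG` for some weight family; Q-row), and
  **`flatOpsAdmAtMS_of_rows`**: if every admissible `(F, n, K, R, M, D, w)` of the text carries `RowsAt … B₀ δ₀ B₃ C_G C_Q`, then
  `FlatOpsAdmAtMS L R₀ M₀ (max B₀ (C_G + B₀·C_Q·C_G)) δ₀ B₃`.  So the registered stub `stub_flatOpsCubeSeq` = «`∃` constants with `RowsAt` at every admissible
  datum» + this file; the rows are [Balaban1984PropagatorsII] §2 for nested families WITH a level-0 region (gap G-F3′-L0, lit-balaban's lane: `B6MultiLevelBoxOperatorL0`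
  p533995 →) plus [Balaban1985Variational] (130) (C-B11-F1 neighbourhood) — every gap NAMED, none restated here as a fact.
HONEST SCOPE.  Finite bookkeeping (triangle inequalities, linearity, canonicity by name); NO estimate is proved here; which rows are dischargeable today (the
one-level family `Domains.whole (K−n)` from p1 g14's menu; the cube sequence only after G-F3′-L0) is the dischargers' business.  NOT a claim about the mass gap.

References: T. Bałaban, CMP **102** (1985) 277–309 [Balaban1985Variational] (46) p.285, (117) p.295, (130) p.298, (143) p.300, (158) p.302, (161)–(163) p.303,
(165) p.304; CMP **96** (1984) 223–250 [Balaban1984PropagatorsII] (2.16) p.225, (2.20) p.226, (2.35) p.228, Prop. 2.6 (2.136) p.247, Cor. 2.8 (2.150)–(2.151) p.249.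
-/

set_option autoImplicit false

noncomputable section

open scoped BigOperators

namespace Summit.QuantumFields.YangMills.Theorems.FlatOpsLettersAssembly

open Literature.MathematicalPhysics.QuantumFieldTheory.Balaban1983to89
open Literature.MathematicalPhysics.QuantumFieldTheory.BalabanImbrieJaffe1984to88.BIJ85AxialPropagator411 (BondSpace)
open B6SectADomainsV1 (Domains)
open B6SectAOperatorsV1 (BondIdx BondIdxSpace QE QsE dcE dcsE)
open B6SectAVectorModelV1 (GE EE)
open B6SectA (hOp)
open B5Prop12FieldsLattice (distSite)
open B11Eq115Space (levOf)
open T3ContinuumYM3Torus (T3Family)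
open FlatCubeOpsText (Adm22 distBI IsLevWeight IsFlatH IsFlatGt HSupLetterG GtSupLetterG GtLaplaceLetterG HDecayLetterD RowSum162
  FlatOpsAdmAtMS)

/-! ## §1 The canonical plain-function operators `Q`, `H`, `G̃` and the pinning of `G` -/

section Generic

variable {P : Params} (D : Domains P)

/-- **`Q` of (2.20) READ ON PLAIN FUNCTIONS**: p21's `QE D : L²(bonds) → L²(𝔅)` transported to `(PBond P 0 → ℝ) →ₗ[ℝ] (𝔅 → ℝ)`;
`(Qfun D u)(c) = (Q_{j(c)}u)(c)` (`Q₀ = id`). [cite: Balaban1984PropagatorsII, (2.20) p.226] -/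
def Qfun : (PBond P 0 → ℝ) →ₗ[ℝ] (BondIdx D → ℝ) :=
  (WithLp.linearEquiv 2 ℝ (BondIdx D → ℝ)).toLinearMap ∘ₗ QE D ∘ₗ (WithLp.linearEquiv 2 ℝ (PBond P 0 → ℝ)).symm.toLinearMap

/-- components of `Qfun`: the iterated bond average at the level of the index bond. [cite: Balaban1984PropagatorsII, (2.20) p.226] -/
theorem Qfun_apply (u : PBond P 0 → ℝ) (c : BondIdx D) : Qfun D u c = QE D (WithLp.toLp 2 u) c := rfl

/-- `Qfun` and `QE` agree as `L²(𝔅)`-vectors. [cite: Balaban1984PropagatorsII, (2.20) p.226] -/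
theorem toLp_Qfun (u : PBond P 0 → ℝ) : WithLp.toLp 2 (Qfun D u) = QE D (WithLp.toLp 2 u) := rfl

end Generic

section Carrier

variable (F : T3Family) (n K : ℕ) (D : Domains (F.P K))

/-- **PRINT'S `H = GQ*(QGQ*)⁻¹` OF THE FAMILY `D` AT THE d = 3 CARRIER, ON PLAIN FUNCTIONS** (lattice factor `L^{K−n} = η⁻¹`, auxiliary weights `a ≡ 1`;
canonical: any positive weights give the same operator, `FlatCubeOperators.hOp_eq_hOp`). [cite: Balaban1985Variational, (45) p.285, (157) p.302; Balaban1984PropagatorsII, (2.35) p.228] -/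
def flatH : (BondIdx D → ℝ) →ₗ[ℝ] (PBond (F.P K) 0 → ℝ) :=
  (WithLp.linearEquiv 2 ℝ (PBond (F.P K) 0 → ℝ)).toLinearMap ∘ₗ
    hOp (GE D (c := (F.L : ℝ) ^ (K - n)) (pow_ne_zero _ (Nat.cast_ne_zero.2 (F.P K).L_pos.ne')) (w := fun _ => (1 : ℝ)) (fun _ => one_pos))
      (QsE D) (EE D (c := (F.L : ℝ) ^ (K - n)) (pow_ne_zero _ (Nat.cast_ne_zero.2 (F.P K).L_pos.ne')) (w := fun _ => (1 : ℝ)) (fun _ => one_pos)) ∘ₗ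
    (WithLp.linearEquiv 2 ℝ (BondIdx D → ℝ)).symm.toLinearMap

/-- `flatH` IS the text's pinned `H` (`IsFlatH`, by `rfl`). [cite: Balaban1985Variational, (157) p.302] -/
theorem isFlatH_flatH : IsFlatH F n K D (flatH F n K D) := fun _ _ => rfl

/-- **PINNING A PLAIN-FUNCTION `G` TO THE GENUINE PROPAGATOR `G = Δ_a⁻¹ = GE D` WITH AN ARBITRARY POSITIVE WEIGHT FAMILY `w′`** (print's `a`, the band
(2.16); lattice factor `L^{K−n}`).  `G` depends on the weights; the `H`, `G̃` built from it do not. [cite: Balaban1984PropagatorsII, (2.16) p.225, (2.19)-(2.22) p.226] -/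
def IsFlatGW {w' : BondIdx D → ℝ} (hw' : ∀ i, 0 < w' i) (G : (PBond (F.P K) 0 → ℝ) →ₗ[ℝ] (PBond (F.P K) 0 → ℝ)) : Prop :=
  ∀ (f : PBond (F.P K) 0 → ℝ) (b : PBond (F.P K) 0),
    G f b = GE D (c := (F.L : ℝ) ^ (K - n)) (pow_ne_zero _ (Nat.cast_ne_zero.2 (F.P K).L_pos.ne')) (w := w') hw' (WithLp.toLp 2 f) b

/-- **`G̃ := G − HQG` ON PLAIN FUNCTIONS** for a plain-function `G` (to be pinned by `IsFlatGW`) and the canonical `flatH`.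
[cite: Balaban1985Variational, (143) p.300, (158) p.302] -/
def gtOf (G : (PBond (F.P K) 0 → ℝ) →ₗ[ℝ] (PBond (F.P K) 0 → ℝ)) : (PBond (F.P K) 0 → ℝ) →ₗ[ℝ] (PBond (F.P K) 0 → ℝ) :=
  G - flatH F n K D ∘ₗ Qfun D ∘ₗ G

/-- components of `G̃f = Gf − H(Q(Gf))`. [cite: Balaban1985Variational, (143) p.300] -/
theorem gtOf_apply (G : (PBond (F.P K) 0 → ℝ) →ₗ[ℝ] (PBond (F.P K) 0 → ℝ)) (f : PBond (F.P K) 0 → ℝ) (b : PBond (F.P K) 0) :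
    gtOf F n K D G f b = G f b - flatH F n K D (Qfun D (G f)) b := by
  simp [gtOf]

/-- **`G̃` BUILT FROM A PINNED `G` IS THE TEXT'S PINNED `G̃`**: if `G` is the genuine propagator with SOME positive weights `w′`, then `gtOf … G` is
`IsFlatGt` (the text's `a ≡ 1` formula) — by the canonicity `Gt_eq_Gt`/`hOp_eq_hOp` of `G − HQG` and `H`. [cite: Balaban1985Variational, (143) p.300; Balaban1984PropagatorsII, (2.35) p.228] -/
theorem isFlatGt_gtOf {w' : BondIdx D → ℝ} (hw' : ∀ i, 0 < w' i) {G : (PBond (F.P K) 0 → ℝ) →ₗ[ℝ] (PBond (F.P K) 0 → ℝ)}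
    (hG : IsFlatGW F n K D hw' G) : IsFlatGt F n K D (gtOf F n K D G) := by
  intro f b
  have hc : ((F.L : ℝ) ^ (K - n)) ≠ 0 := pow_ne_zero _ (Nat.cast_ne_zero.2 (F.P K).L_pos.ne')
  -- `G f` IS `GE_{w′}(f)` as an `L²`-vector
  have hGf : WithLp.toLp 2 (G f) = GE D hc hw' (WithLp.toLp 2 f) := by
    ext b'
    exact hG f b'
  rw [gtOf_apply, FlatCubeOperators.Gt_eq_Gt D hc (fun _ => one_pos) hw' (WithLp.toLp 2 f)]
  simp only [LinearMap.sub_apply, LinearMap.comp_apply]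
  rw [← FlatCubeOperators.hOp_eq_hOp D hc (fun _ => one_pos) hw', ← hGf, hG f b, ← hGf]
  rfl

end Carrier

/-! ## §2 The two extra row schemas: the Laplacian row of `H` and the contraction row of `Q` -/

section Rows

variable (F : T3Family) (n K : ℕ) (D : Domains (F.P K))

/-- **THE LAPLACIAN SUP ROW OF `H`** = [Balaban1985Variational] (130) at `U₀ = 1` in the text's normalisation: for data `(L^{j(c)}η)|X(c)| ≤ t`,
`(L^{j(b)}η)³·η⁻²·|(ΔHX)(b)| ≤ B₀·t` (`Δ` = the componentwise second-difference sum, guarded `0 ≤ t`). [cite: Balaban1985Variational, (130) p.298, (137)-(140) p.298-299] -/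
def HLapLetterG (w : ℕ → PBond (F.P K) 0 → ℝ) (H : (BondIdx D → ℝ) →ₗ[ℝ] (PBond (F.P K) 0 → ℝ)) (B₀ : ℝ) : Prop :=
  ∀ (X : BondIdx D → ℝ) (t : ℝ), 0 ≤ t → (∀ c, ((F.L : ℝ) ^ ((c.1.1 : ℕ)) * ((F.L : ℝ)⁻¹) ^ (K - n)) * |X c| ≤ t) →
    ∀ (b : PBond (F.P K) 0),
      w 3 b * ((F.L : ℝ) ^ (K - n)) ^ 2 * |∑ ν : Fin 3, ((H X b - H X ⟨b.src.shift ν, b.dir⟩) + (H X b - H X ⟨b.src.unshift ν, b.dir⟩))| ≤ B₀ * t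

/-- **THE CONTRACTION ROW OF THE AVERAGING `Q`** (lattice geometry; PROVED in `…Prop8FlatCubeQContraction`, a named row here): for a fine bond function with
`(L^{j(b)}η)|u(b)| ≤ r`, the index-bond data `Qu` has `(L^{j(c)}η)|(Qu)(c)| ≤ C_Q·r` (`(Q_ju)(c)` is a convex combination of the `u(b)`, `b` under
`Bʲ(c₋) ∪ Bʲ(c₊)`). [cite: Balaban1984PropagatorsI, (1.11) p.19, (1.18) p.20; Balaban1984PropagatorsII, (2.20) p.226] -/
def QContrLetter (w : ℕ → PBond (F.P K) 0 → ℝ) (CQ : ℝ) : Prop :=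
  ∀ (u : PBond (F.P K) 0 → ℝ) (r : ℝ), 0 ≤ r → (∀ b, w 1 b * |u b| ≤ r) →
    ∀ c : BondIdx D, ((F.L : ℝ) ^ ((c.1.1 : ℕ)) * ((F.L : ℝ)⁻¹) ^ (K - n)) * |Qfun D u c| ≤ CQ * r

end Rows

/-! ## §3 Monotonicity in the constants; the level weights are nonnegative -/

section Mono

variable {F : T3Family} {n K : ℕ} {D : Domains (F.P K)} {w : ℕ → PBond (F.P K) 0 → ℝ}

/-- the level weights `(L^{j(b)}η)^m` are nonnegative. [cite: Balaban1985Variational, p.286] -/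
theorem levWeight_nonneg (hw : IsLevWeight F n K D w) (m : ℕ) (b : PBond (F.P K) 0) : 0 ≤ w m b := by
  rw [hw m b]
  positivity

/-- (46) is monotone in `B₀`. [cite: Balaban1985Variational, (46) p.285] -/
theorem hSupLetterG_mono {H : (BondIdx D → ℝ) →ₗ[ℝ] (PBond (F.P K) 0 → ℝ)} {B B' : ℝ} (h : HSupLetterG F n K D w H B) (hBB' : B ≤ B') :
    HSupLetterG F n K D w H B' := by
  intro X t ht hX
  obtain ⟨h1, h2⟩ := h X t ht hX
  exact ⟨fun b => (h1 b).trans (mul_le_mul_of_nonneg_right hBB' ht), fun b ν => (h2 b ν).trans (mul_le_mul_of_nonneg_right hBB' ht)⟩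

/-- (130) is monotone in `B₀`. [cite: Balaban1985Variational, (130) p.298] -/
theorem hLapLetterG_mono {H : (BondIdx D → ℝ) →ₗ[ℝ] (PBond (F.P K) 0 → ℝ)} {B B' : ℝ} (h : HLapLetterG F n K D w H B) (hBB' : B ≤ B') :
    HLapLetterG F n K D w H B' :=
  fun X t ht hX b => (h X t ht hX b).trans (mul_le_mul_of_nonneg_right hBB' ht)

/-- the `(−3) → (−1), (−2)` rows are monotone in the constant. [cite: Balaban1985Variational, (117) p.295, (165) p.304] -/
theorem gtSupLetterG_mono {G : (PBond (F.P K) 0 → ℝ) →ₗ[ℝ] (PBond (F.P K) 0 → ℝ)} {B B' : ℝ} (h : GtSupLetterG F n K w G B) (hBB' : B ≤ B') :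
    GtSupLetterG F n K w G B' := by
  intro f β hβ hf
  obtain ⟨h1, h2⟩ := h f β hβ hf
  exact ⟨fun b => (h1 b).trans (mul_le_mul_of_nonneg_right hBB' hβ), fun b ν => (h2 b ν).trans (mul_le_mul_of_nonneg_right hBB' hβ)⟩

/-- the Laplacian row is monotone in the constant. [cite: Balaban1985Variational, (165) p.304] -/
theorem gtLaplaceLetterG_mono {G : (PBond (F.P K) 0 → ℝ) →ₗ[ℝ] (PBond (F.P K) 0 → ℝ)} {B B' : ℝ} (h : GtLaplaceLetterG F n K w G B)
    (hBB' : B ≤ B') : GtLaplaceLetterG F n K w G B' :=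
  fun f β hβ hf b => (h f β hβ hf b).trans (mul_le_mul_of_nonneg_right hBB' hβ)

/-- (161)₁ is monotone in `B₀` (its right-hand side is `B₀` times a nonnegative sum). [cite: Balaban1985Variational, (161) p.303] -/
theorem hDecayLetterD_mono {dBI : PBond (F.P K) 0 → BondIdx D → ℝ} {H : (BondIdx D → ℝ) →ₗ[ℝ] (PBond (F.P K) 0 → ℝ)} {B B' δ₀ : ℝ}
    (h : HDecayLetterD F n K D dBI w H B δ₀) (hBB' : B ≤ B') : HDecayLetterD F n K D dBI w H B' δ₀ := by
  intro X b
  have hS : 0 ≤ ∑ c, Real.exp (-(δ₀ * dBI b c)) * |X c| :=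
    Finset.sum_nonneg fun c _ => mul_nonneg (Real.exp_pos _).le (abs_nonneg _)
  obtain ⟨h1, h2, h3, h4⟩ := h X b
  exact ⟨h1.trans (mul_le_mul_of_nonneg_right hBB' hS), fun ν => (h2 ν).trans (mul_le_mul_of_nonneg_right hBB' hS),
    h3.trans (mul_le_mul_of_nonneg_right hBB' hS), h4.trans (mul_le_mul_of_nonneg_right hBB' hS)⟩

/-- the contraction row is monotone in `C_Q`. [cite: Balaban1984PropagatorsII, (2.20) p.226] -/
theorem qContrLetter_mono {C C' : ℝ} (h : QContrLetter F n K D w C) (hCC' : C ≤ C') : QContrLetter F n K D w C' :=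
  fun u r hr hu c => (h u r hr hu c).trans (mul_le_mul_of_nonneg_right hCC' hr)

end Mono

/-! ## §4 The letters of `G̃ = G − HQG` from the rows of `G`, `Q`, `H` -/

section Assembly

variable {F : T3Family} {n K : ℕ} {D : Domains (F.P K)} {w : ℕ → PBond (F.P K) 0 → ℝ}

/-- **THE `(−3) → (−1), (−2)` LETTERS OF `G̃ = G − HQG`** from the same letters of `G`, the contraction of `Q` and (46) for `H` (triangle inequality; the
pattern of `FlatConstrainedPropagatorLetters.letters_G_sub_HQG` in the guarded multi-weight shapes): `G̃` carries the constant `C_G + B_H·C_Q·C_G`.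
[cite: Balaban1985Variational, (143) p.300, (158) p.302, (165) p.304; Balaban1984PropagatorsII, Prop. 2.6 (2.136) p.247] -/
theorem gtSupLetterG_gtOf (hw0 : ∀ m b, 0 ≤ w m b) {G : (PBond (F.P K) 0 → ℝ) →ₗ[ℝ] (PBond (F.P K) 0 → ℝ)} {CG CQ BH : ℝ}
    (hCG : 0 ≤ CG) (hCQ : 0 ≤ CQ) (hG : GtSupLetterG F n K w G CG) (hQ : QContrLetter F n K D w CQ)
    (hH : HSupLetterG F n K D w (flatH F n K D) BH) :
    GtSupLetterG F n K w (gtOf F n K D G) (CG + BH * CQ * CG) := by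
  intro f β hβ hf
  obtain ⟨hG0, hG1⟩ := hG f β hβ hf
  have hQG := hQ (G f) (CG * β) (mul_nonneg hCG hβ) hG0
  obtain ⟨hH0, hH1⟩ := hH (Qfun D (G f)) (CQ * (CG * β)) (mul_nonneg hCQ (mul_nonneg hCG hβ)) hQG
  refine ⟨fun b => ?_, fun b ν => ?_⟩
  · rw [gtOf_apply]
    calc w 1 b * |G f b - flatH F n K D (Qfun D (G f)) b|
        ≤ w 1 b * (|G f b| + |flatH F n K D (Qfun D (G f)) b|) := mul_le_mul_of_nonneg_left (abs_sub _ _) (hw0 1 b)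
      _ = w 1 b * |G f b| + w 1 b * |flatH F n K D (Qfun D (G f)) b| := mul_add _ _ _
      _ ≤ CG * β + BH * (CQ * (CG * β)) := add_le_add (hG0 b) (hH0 b)
      _ = (CG + BH * CQ * CG) * β := by ring
  · rw [gtOf_apply, gtOf_apply]
    have e : G f ⟨b.src.shift ν, b.dir⟩ - flatH F n K D (Qfun D (G f)) ⟨b.src.shift ν, b.dir⟩ - (G f b - flatH F n K D (Qfun D (G f)) b) =
        (G f ⟨b.src.shift ν, b.dir⟩ - G f b) - (flatH F n K D (Qfun D (G f)) ⟨b.src.shift ν, b.dir⟩ - flatH F n K D (Qfun D (G f)) b) := by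
      ring
    rw [e]
    have hw2 : 0 ≤ w 2 b * (F.L : ℝ) ^ (K - n) := mul_nonneg (hw0 2 b) (pow_nonneg (Nat.cast_nonneg _) _)
    calc w 2 b * (F.L : ℝ) ^ (K - n) *
          |(G f ⟨b.src.shift ν, b.dir⟩ - G f b) - (flatH F n K D (Qfun D (G f)) ⟨b.src.shift ν, b.dir⟩ - flatH F n K D (Qfun D (G f)) b)|
        ≤ w 2 b * (F.L : ℝ) ^ (K - n) *
          (|G f ⟨b.src.shift ν, b.dir⟩ - G f b| + |flatH F n K D (Qfun D (G f)) ⟨b.src.shift ν, b.dir⟩ - flatH F n K D (Qfun D (G f)) b|) :=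
          mul_le_mul_of_nonneg_left (abs_sub _ _) hw2
      _ = w 2 b * (F.L : ℝ) ^ (K - n) * |G f ⟨b.src.shift ν, b.dir⟩ - G f b| +
          w 2 b * (F.L : ℝ) ^ (K - n) * |flatH F n K D (Qfun D (G f)) ⟨b.src.shift ν, b.dir⟩ - flatH F n K D (Qfun D (G f)) b| := mul_add _ _ _
      _ ≤ CG * β + BH * (CQ * (CG * β)) := add_le_add (hG1 b ν) (hH1 b ν)
      _ = (CG + BH * CQ * CG) * β := by ring

/-- **THE LAPLACIAN LETTER OF `G̃ = G − HQG`** from the Laplacian row of `G` ((2.136)₄), the `(−3) → (−1)` row of `G` feeding `Q`, the contraction of `Q`, and the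
Laplacian row (130) of `H`: constant `C_Δ + B_Δ·C_Q·C_G`. [cite: Balaban1985Variational, (165) p.304, (130) p.298; Balaban1984PropagatorsII, Prop. 2.6 (2.136) p.247] -/
theorem gtLaplaceLetterG_gtOf (hw0 : ∀ m b, 0 ≤ w m b) {G : (PBond (F.P K) 0 → ℝ) →ₗ[ℝ] (PBond (F.P K) 0 → ℝ)} {CG CL CQ BL : ℝ}
    (hCG : 0 ≤ CG) (hCQ : 0 ≤ CQ) (hG : GtSupLetterG F n K w G CG) (hGL : GtLaplaceLetterG F n K w G CL) (hQ : QContrLetter F n K D w CQ)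
    (hHL : HLapLetterG F n K D w (flatH F n K D) BL) :
    GtLaplaceLetterG F n K w (gtOf F n K D G) (CL + BL * CQ * CG) := by
  intro f β hβ hf b
  obtain ⟨hG0, _⟩ := hG f β hβ hf
  have hQG := hQ (G f) (CG * β) (mul_nonneg hCG hβ) hG0
  have hL := hGL f β hβ hf b
  have hH := hHL (Qfun D (G f)) (CQ * (CG * β)) (mul_nonneg hCQ (mul_nonneg hCG hβ)) hQG b
  set u : PBond (F.P K) 0 → ℝ := G f with hu
  set v : PBond (F.P K) 0 → ℝ := flatH F n K D (Qfun D (G f)) with hv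
  have e : ∑ ν : Fin 3, ((gtOf F n K D G f b - gtOf F n K D G f ⟨b.src.shift ν, b.dir⟩) +
        (gtOf F n K D G f b - gtOf F n K D G f ⟨b.src.unshift ν, b.dir⟩)) =
      ∑ ν : Fin 3, ((u b - u ⟨b.src.shift ν, b.dir⟩) + (u b - u ⟨b.src.unshift ν, b.dir⟩)) -
        ∑ ν : Fin 3, ((v b - v ⟨b.src.shift ν, b.dir⟩) + (v b - v ⟨b.src.unshift ν, b.dir⟩)) := by
    rw [← Finset.sum_sub_distrib]
    refine Finset.sum_congr rfl fun ν _ => ?_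
    simp only [gtOf_apply, hu, hv]
    ring
  rw [e]
  have hw3 : 0 ≤ w 3 b * ((F.L : ℝ) ^ (K - n)) ^ 2 := mul_nonneg (hw0 3 b) (pow_nonneg (pow_nonneg (Nat.cast_nonneg _) _) _)
  calc w 3 b * ((F.L : ℝ) ^ (K - n)) ^ 2 *
        |∑ ν : Fin 3, ((u b - u ⟨b.src.shift ν, b.dir⟩) + (u b - u ⟨b.src.unshift ν, b.dir⟩)) -
          ∑ ν : Fin 3, ((v b - v ⟨b.src.shift ν, b.dir⟩) + (v b - v ⟨b.src.unshift ν, b.dir⟩))|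
      ≤ w 3 b * ((F.L : ℝ) ^ (K - n)) ^ 2 *
        (|∑ ν : Fin 3, ((u b - u ⟨b.src.shift ν, b.dir⟩) + (u b - u ⟨b.src.unshift ν, b.dir⟩))| +
          |∑ ν : Fin 3, ((v b - v ⟨b.src.shift ν, b.dir⟩) + (v b - v ⟨b.src.unshift ν, b.dir⟩))|) :=
        mul_le_mul_of_nonneg_left (abs_sub _ _) hw3
    _ = w 3 b * ((F.L : ℝ) ^ (K - n)) ^ 2 * |∑ ν : Fin 3, ((u b - u ⟨b.src.shift ν, b.dir⟩) + (u b - u ⟨b.src.unshift ν, b.dir⟩))| +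
        w 3 b * ((F.L : ℝ) ^ (K - n)) ^ 2 * |∑ ν : Fin 3, ((v b - v ⟨b.src.shift ν, b.dir⟩) + (v b - v ⟨b.src.unshift ν, b.dir⟩))| :=
        mul_add _ _ _
    _ ≤ CL * β + BL * (CQ * (CG * β)) := add_le_add hL hH
    _ = (CL + BL * CQ * CG) * β := by ring

end Assembly

/-! ## §5 The input row list of P2 and the assembly of `FlatOpsAdmAtMS` -/

section Main

variable (F : T3Family) (n K : ℕ) (D : Domains (F.P K))

/-- **THE INPUT ROW LIST OF P2 AT ONE ADMISSIBLE DATUM `(F, n, K, D, w)`** — every entry a printed row, NAMED: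
(H) for the canonical `flatH`: (46) `HSupLetterG … B₀`, (130) `HLapLetterG … B₀`, and a distance `dBI ≥ distBI` carrying the (162) row sum `RowSum162 … δ₀ B₃` and the
four (161)₁ rows `HDecayLetterD … B₀ δ₀` ([Balaban1984PropagatorsII] Cor. 2.8 (2.150)–(2.151) + [Balaban1985Variational] (130)/(137)–(140), in the (2.46) multiscale
distance); (G) for the genuine `G = Δ_a⁻¹` with SOME positive weight family: the rows `(−3) → (−1), (−2)` and the Laplacian row of [Balaban1984PropagatorsII] Prop. 2.6
(2.136)₁,₂,₄, constant `C_G` (stated through the text's `GtSupLetterG`/`GtLaplaceLetterG` shapes); (Q) the contraction row, constant `C_Q`.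
[cite: Balaban1984PropagatorsII, Prop. 2.6 (2.136) p.247, Cor. 2.8 (2.150)-(2.151) p.249, (2.46) p.231; Balaban1985Variational, (46) p.285, (130) p.298, (161)-(163) p.303] -/
def RowsAt (w : ℕ → PBond (F.P K) 0 → ℝ) (B₀ δ₀ B₃ CG CQ : ℝ) : Prop :=
  (HSupLetterG F n K D w (flatH F n K D) B₀ ∧ HLapLetterG F n K D w (flatH F n K D) B₀ ∧
    ∃ dBI : PBond (F.P K) 0 → BondIdx D → ℝ,
      (∀ b c, distBI D b c ≤ dBI b c) ∧ RowSum162 F n K D dBI w δ₀ B₃ ∧ HDecayLetterD F n K D dBI w (flatH F n K D) B₀ δ₀) ∧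
  (∃ (w' : BondIdx D → ℝ) (hw' : ∀ i, 0 < w' i) (G : (PBond (F.P K) 0 → ℝ) →ₗ[ℝ] (PBond (F.P K) 0 → ℝ)),
      IsFlatGW F n K D hw' G ∧ GtSupLetterG F n K w G CG ∧ GtLaplaceLetterG F n K w G CG) ∧
  QContrLetter F n K D w CQ

variable {F n K D}

/-- **THE BODY OF `FlatOpsAdmAtMS` AT ONE DATUM FROM ITS ROW LIST**: with nonnegative weights and `C_G, C_Q ≥ 0`, `RowsAt … B₀ δ₀ B₃ C_G C_Q` yields the canonical pair
`(flatH, gtOf G)` pinned as `IsFlatH`/`IsFlatGt` with the text's five letters at the constant `max B₀ (C_G + B₀·C_Q·C_G)` and the same `dBI`, `δ₀`, `B₃`.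
[cite: Balaban1985Variational, (46) p.285, (130) p.298, (143) p.300, (158) p.302, (161)-(163) p.303, (165) p.304; Balaban1984PropagatorsII, Prop. 2.6 (2.136) p.247, Cor. 2.8 p.249] -/
theorem body_of_rowsAt {w : ℕ → PBond (F.P K) 0 → ℝ} (hw0 : ∀ m b, 0 ≤ w m b) {B₀ δ₀ B₃ CG CQ : ℝ} (hCG : 0 ≤ CG) (hCQ : 0 ≤ CQ)
    (h : RowsAt F n K D w B₀ δ₀ B₃ CG CQ) :
    ∃ (H : (BondIdx D → ℝ) →ₗ[ℝ] (PBond (F.P K) 0 → ℝ)) (Gt : (PBond (F.P K) 0 → ℝ) →ₗ[ℝ] (PBond (F.P K) 0 → ℝ)),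
      IsFlatH F n K D H ∧ IsFlatGt F n K D Gt ∧
      HSupLetterG F n K D w H (max B₀ (CG + B₀ * CQ * CG)) ∧ GtSupLetterG F n K w Gt (max B₀ (CG + B₀ * CQ * CG)) ∧
        GtLaplaceLetterG F n K w Gt (max B₀ (CG + B₀ * CQ * CG)) ∧
      ∃ dBI : PBond (F.P K) 0 → BondIdx D → ℝ,
        (∀ b c, distBI D b c ≤ dBI b c) ∧ RowSum162 F n K D dBI w δ₀ B₃ ∧ HDecayLetterD F n K D dBI w H (max B₀ (CG + B₀ * CQ * CG)) δ₀ := by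
  obtain ⟨⟨hHsup, hHlap, dBI, hcomp, hrow, hHdec⟩, ⟨w', hw', G, hGpin, hGsup, hGlap⟩, hQ⟩ := h
  refine ⟨flatH F n K D, gtOf F n K D G, isFlatH_flatH F n K D, isFlatGt_gtOf F n K D hw' hGpin,
    hSupLetterG_mono hHsup (le_max_left _ _), ?_, ?_, dBI, hcomp, hrow, hDecayLetterD_mono hHdec (le_max_left _ _)⟩
  · exact gtSupLetterG_mono (gtSupLetterG_gtOf hw0 hCG hCQ hGsup hQ hHsup) (le_max_right _ _)
  · exact gtLaplaceLetterG_mono (gtLaplaceLetterG_gtOf hw0 hCG hCQ hGsup hGlap hQ hHlap) (le_max_right _ _)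

/-- **P2 FROM ITS ROW LIST — THE ASSEMBLY OF THE REGISTERED TEXT**: if every admissible datum of `FlatOpsAdmAtMS L R₀ M₀ …` (member `F.L = L`, heights `n < K`,
`R ≥ R₀`, `M ≥ M₀` a power of `L`, nested family `D` with `D.k = K − n` and `Adm22 D R M`, level weights `w`) carries `RowsAt F n K D w B₀ δ₀ B₃ C_G C_Q`, then
`FlatOpsAdmAtMS L R₀ M₀ (max B₀ (C_G + B₀·C_Q·C_G)) δ₀ B₃`.  Hence `stub_flatOpsCubeSeq` = the rows at every admissible datum (gap G-F3′-L0 + (130)) + this theorem.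
[cite: Balaban1985Variational, (46) p.285, (130) p.298, (157)-(158) p.302, (161)-(163) p.303, (165) p.304; Balaban1984PropagatorsII, Prop. 2.6 (2.136) p.247, Cor. 2.8 (2.150)-(2.151) p.249] -/
theorem flatOpsAdmAtMS_of_rows {L R₀ M₀ : ℕ} {B₀ δ₀ B₃ CG CQ : ℝ} (hCG : 0 ≤ CG) (hCQ : 0 ≤ CQ)
    (h : ∀ (F : T3Family), F.L = L → ∀ (n K : ℕ), n < K → ∀ (R M : ℕ), R₀ ≤ R → M₀ ≤ M → (∃ a : ℕ, M = L ^ a) →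
      ∀ (D : Domains (F.P K)), D.k = K - n → Adm22 D R M →
      ∀ (w : ℕ → PBond (F.P K) 0 → ℝ), IsLevWeight F n K D w → RowsAt F n K D w B₀ δ₀ B₃ CG CQ) :
    FlatOpsAdmAtMS L R₀ M₀ (max B₀ (CG + B₀ * CQ * CG)) δ₀ B₃ := by
  intro F hF n K hnK R M hR hM hMa D hDk hAdm w hw
  exact body_of_rowsAt (levWeight_nonneg hw) hCG hCQ (h F hF n K hnK R M hR hM hMa D hDk hAdm w hw)

end Main

end Summit.QuantumFields.YangMills.Theorems.FlatOpsLettersAssembly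

end
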